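import Summits.FinalStateConjecture.FinalStateConjecture.Theorems.EIHFluxBalanceInertialRecessionStubEndgameOraclePassage
import Summits.FinalStateConjecture.FinalStateConjecture.Theorems.EIHFluxBalanceInertialRecessionStubEndgameOracleCover
import Summits.FinalStateConjecture.FinalStateConjecture.Theorems.EIHFluxBalanceInertialRecessionStubEndgameBasics

/-!
# Route EIHFluxBalance — crux `InertialRecession`, line `sublinear-is-free-clean-window-charges`:
# bad stretches of a slow pair are short (`stretch_length_le`) and the proxy coordinate gains linearly (`proxy_gain`)

Helper file for the crux `stmt-FinalStateConjecture-10166`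
(`Summit.FinalStateConjecture.FinalStateConjecture.Theses.EIHFluxBalance.InertialRecession`), registered stub `stub_incrementOracle`
(lead reshape r9/r10) of `Cruxes/InertialRecession/Lines/sublinear_is_free_clean_window_charges.lean`; lead's roadmap §9 (`|S| = 2`).

* `proxy_gain` — for `C¹` centres and a unit direction `n` with `⟪ξ̇ₘ − ξ̇ₖ, n⟫ ≥ W/2` on `[a,b]`, the proxy `x = ⟪ξₘ − ξₖ, n⟫` gains at least
  `(W/2)(s′ − s)`, and `|x| ≤ ‖ξₘ − ξₖ‖`.
* `stretch_length_le` — if `(τ, τ′)` is covered by the passage sets `{|x_m| < 3d}` of the outsiders `m ∈ O` (pair distance `d` σ-slow,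
  `78σ ≤ W`, `120|O|σ ≤ W`), then `τ′ − τ ≤ 15|O|·d(τ)/W`: otherwise the initial piece of length `L₀ = 15|O|d(τ)/W` would be covered by
  `|O|` intervals each of length `≤ 13(d(τ) + σL₀)/W` (`passage_length_le`, `sub_le_card_mul_of_cover`), which is `< L₀`.
-/

noncomputable section

set_option linter.dupNamespace false

open Set MeasureTheory
open scoped InnerProductSpace RealInnerProductSpace

namespace Summit.FinalStateConjecture.FinalStateConjecture.Theorems.SublinearIsFree.Oracle

open Literature.Geometry.Lorentzian

/-- **THE PROXY COORDINATE GAINS LINEARLY.** See the module docstring. [folklore] -/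
theorem proxy_gain {ξk ξm : ℝ → E3} (hk : ContDiff ℝ 1 ξk) (hm : ContDiff ℝ 1 ξm) {n : E3} {a b W : ℝ}
    (hspeed : ∀ s ∈ Icc a b, W / 2 ≤ ⟪deriv ξm s - deriv ξk s, n⟫) :
    ∀ s ∈ Icc a b, ∀ s' ∈ Icc a b, s ≤ s' → W / 2 * (s' - s) ≤ ⟪ξm s' - ξk s', n⟫ - ⟪ξm s - ξk s, n⟫ := by
  set x : ℝ → ℝ := fun s ↦ ⟪ξm s - ξk s, n⟫ with hx
  have hdm : Differentiable ℝ ξm := hm.differentiable one_ne_zero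
  have hdk : Differentiable ℝ ξk := hk.differentiable one_ne_zero
  have hxd : ∀ s, HasDerivAt x ⟪deriv ξm s - deriv ξk s, n⟫ s := fun s ↦ by
    have h := HasDerivAt.inner ℝ (((hdm s).hasDerivAt).sub ((hdk s).hasDerivAt)) (hasDerivAt_const s n)
    simpa [hx] using h
  have hcont : ContinuousOn x (Icc a b) := fun s _ ↦ (hxd s).continuousAt.continuousWithinAt
  have hdiff : DifferentiableOn ℝ x (interior (Icc a b)) := fun s _ ↦ (hxd s).differentiableAt.differentiableWithinAt
  have hge : ∀ s ∈ interior (Icc a b), W / 2 ≤ deriv x s := by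
    intro s hs
    rw [(hxd s).deriv]
    exact hspeed s (interior_subset hs)
  intro s hs s' hs' hss'
  exact (convex_Icc a b).mul_sub_le_image_sub_of_le_deriv hcont hdiff hge s hs s' hs' hss'

/-- The proxy is dominated by the distance: `|⟪ξₘ − ξₖ, n⟫| ≤ ‖ξₘ − ξₖ‖` for `‖n‖ = 1`. [folklore] -/
theorem abs_proxy_le_dist {u n : E3} (hn : ‖n‖ = 1) : |⟪u, n⟫| ≤ ‖u‖ := by
  calc |⟪u, n⟫| ≤ ‖u‖ * ‖n‖ := abs_real_inner_le_norm _ _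
    _ = ‖u‖ := by rw [hn, mul_one]

set_option maxHeartbeats 800000 in
/-- **BAD STRETCHES ARE SHORT.** See the module docstring. `x m` are the proxies of the outsiders `m ∈ O` relative to the reference
(two-point gains `≥ (W/2)Δs` on `[a,b]`), `d` the pair distance (two-point `σ`-slow on `[a,b]`, positive at `τ`). [folklore] -/
theorem stretch_length_le {ι : Type*} (O : Finset ι) (x : ι → ℝ → ℝ) (d : ℝ → ℝ) {a b τ τ' W σ : ℝ}
    (hW : 0 < W) (hσ0 : 0 ≤ σ) (hσ1 : 78 * σ ≤ W) (hσ2 : 120 * O.card * σ ≤ W)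
    (haτ : a ≤ τ) (hτ'b : τ' ≤ b) (hdτ : 0 < d τ)
    (hx : ∀ m ∈ O, ∀ s ∈ Icc a b, ∀ s' ∈ Icc a b, s ≤ s' → W / 2 * (s' - s) ≤ x m s' - x m s)
    (hd : ∀ s ∈ Icc a b, ∀ s' ∈ Icc a b, s ≤ s' → |d s' - d s| ≤ σ * (s' - s))
    (hcover : Ioo τ τ' ⊆ ⋃ m ∈ O, {s | s ∈ Icc a b ∧ |x m s| < 3 * d s}) :
    τ' - τ ≤ 15 * O.card * d τ / W := by
  classical
  set L₀ : ℝ := 15 * O.card * d τ / W with hL₀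
  have hL₀0 : 0 ≤ L₀ := by positivity
  by_contra hcon
  push Not at hcon
  -- the initial piece `(τ, τ + L₀)` and its cover by the passage sets restricted to `[τ, τ + L₀]`
  have hτL : τ + L₀ ≤ b := by linarith
  set J : ι → Set ℝ := fun m ↦ {s | s ∈ Icc τ (τ + L₀) ∧ |x m s| - 3 * d s < 0} with hJ
  have hsubI : Icc τ (τ + L₀) ⊆ Icc a b := fun s hs ↦ ⟨haτ.trans hs.1, hs.2.trans hτL⟩
  have hcover' : Ioo τ (τ + L₀) ⊆ ⋃ m ∈ O, J m := by
    intro s hs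
    have hs' : s ∈ Ioo τ τ' := ⟨hs.1, by linarith [hs.2]⟩
    obtain ⟨m, hm, hsm⟩ : ∃ m ∈ O, s ∈ {s | s ∈ Icc a b ∧ |x m s| < 3 * d s} := by
      simpa only [mem_iUnion, exists_prop] using hcover hs'
    refine mem_iUnion₂.mpr ⟨m, hm, ?_⟩
    exact ⟨⟨hs.1.le, hs.2.le⟩, by linarith [hsm.2]⟩
  -- each `J m` is `K`-short with `K = 13 (d τ + σ L₀) / W`
  set K : ℝ := 13 * (d τ + σ * L₀) / W with hK
  have hK0 : 0 ≤ K := by positivity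
  have hshort : ∀ m ∈ O, ∀ p ∈ J m, ∀ q ∈ J m, q - p ≤ K := by
    intro m hm p hp q hq
    rcases le_or_gt p q with hpq | hpq
    · have hp' : p ∈ Icc a b := hsubI hp.1
      have hq' : q ∈ Icc a b := hsubI hq.1
      have hgain := hx m hm p hp' q hq' hpq
      have hslow := hd p hp' q hq' hpq
      have hlen := passage_length_le (x := x m) (d := d) hW hσ1 hpq hgain hslow (by linarith [hp.2]) (by linarith [hq.2])
      -- `d p ≤ d τ + σ L₀`
      have hdp : d p ≤ d τ + σ * L₀ := by
        have h1 := hd τ ⟨haτ, by linarith⟩ p hp' hp.1.1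
        rw [abs_le] at h1
        have h2 : σ * (p - τ) ≤ σ * L₀ := mul_le_mul_of_nonneg_left (by linarith [hp.1.2]) hσ0
        linarith [h1.2]
      calc q - p ≤ 13 * d p / W := hlen
        _ ≤ K := by rw [hK]; exact div_le_div_of_nonneg_right (by linarith) hW.le
    · linarith
  have hcov := sub_le_card_mul_of_cover O J hK0 hshort hcover'
  -- `L₀ ≤ |O| K` contradicts the choice of `L₀`
  have hOσ : 13 * O.card * σ ≤ W / 9 := by nlinarith [hσ2]
  have hO0 : (0 : ℝ) ≤ O.card := Nat.cast_nonneg _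
  rcases Nat.eq_zero_or_pos O.card with hO | hO
  · -- no outsiders: the piece cannot be covered unless it is empty
    have hO' : (O.card : ℝ) = 0 := by exact_mod_cast hO
    have : τ + L₀ - τ ≤ 0 := by simpa [hO'] using hcov
    have hL : L₀ = 0 := by linarith
    rw [hL] at hcon
    -- then `(τ, τ')` is nonempty but covered by nothing
    have hmid : (τ + τ') / 2 ∈ Ioo τ τ' := ⟨by linarith, by linarith⟩
    have := hcover hmid
    rw [Finset.card_eq_zero.mp hO] at this
    simp at this
  · have hO1 : (1 : ℝ) ≤ O.card := by exact_mod_cast hO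
    have h1 : τ + L₀ - τ = L₀ := by ring
    rw [h1] at hcov
    -- `L₀ ≤ |O| · 13 (dτ + σ L₀)/W`
    have h2 : L₀ * W ≤ O.card * (13 * (d τ + σ * L₀)) := by
      have := hcov; rw [hK] at this
      rw [mul_div_assoc'] at this
      rwa [le_div_iff₀ hW] at this
    have h3 : L₀ * W = 15 * O.card * d τ := by rw [hL₀]; field_simp
    nlinarith [h2, h3, hOσ, hdτ, hO1, hL₀0]

/-- Registered helper form of `abs_proxy_le_dist` (carrier of this file). [folklore] -/
theorem oracle_abs_proxy_le_dist : ∀ (u n : E3), ‖n‖ = 1 → |inner ℝ u n| ≤ ‖u‖ :=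
  fun _ _ hn ↦ abs_proxy_le_dist hn

end Summit.FinalStateConjecture.FinalStateConjecture.Theorems.SublinearIsFree.Oracle

end
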